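import Literature.Barriers.CriticalPhenomena.TimarMassTransport
import Literature.Barriers.CriticalPhenomena.TimarCutQuasiTransitive
import HarnessLib

/-!
# Timár 2006, §5 on QUASI-TRANSITIVE graphs: the MTP contradiction for unit-mass point
# allocations ("the expected mass received is infinite; the expected mass sent out is at most 1")
# — PROVED

Barrier catalogue `Literature/Barriers/CriticalPhenomena/`; the quasi-transitive twin of
`measure_isSome_eq` of `TimarMassTransport.lean` (TRANSITIVE graphs: for an equivariant point
allocation `τ`, `P(τ(x) defined) = w(x)⁻¹ E[Σ_{y : τ(y) = x} w(y)]`), in the form in which the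
proof of Lemma 5.3 uses it. Á. Timár, *Percolation on nonunimodular transitive graphs*, Ann.
Probab. 34 (2006) 2344–2364, §5, proof of Lemma 5.3 (p. 2357):

> "Then let each vertex `y` … send mass `1` to `x` … Since `C ∩ L₀` is infinite …, the expected
> mass received is infinite. The expected mass sent out is at most `1`. This MTP contradiction
> proves the second part of the claimed assertion."

On a quasi-transitive graph the identity per vertex is replaced by the tilted MTP summed over a
complete set `R` of orbit representatives (`sum_inv_autWeight_mul_lintegral_tsum_eq_tilted`,
`NonunimodularMTPQuasiTransitive.lean`): the summed mass sent is `≤ Σ_r w(r)⁻¹ · P(Ω) < ∞`,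
whereas if an invariant family of "bad" events `Bad x` — on which infinitely many vertices of
weight bounded below send their unit mass to `x` — had positive probability at some
representative, the summed `Δ`-weighted mass received would be infinite (`Δ(y) ≥ w(y)/max_R w`).
Hence `P(Bad r) = 0` at the representatives, and at every vertex by invariance:
`measure_eq_zero_of_infinite_senders_quasiTransitive`.

## References

* Á. Timár, Ann. Probab. 34 (2006) 2344–2364 (arXiv:math/0702875), §5, Lemma 5.3 (proof: the
  MTP contradiction); Lemma 2.2. [Timar2006]
* R. Lyons, Y. Peres, *Probability on Trees and Networks*, CUP 2016, §8.2 ((8.10), Cor. 8.11).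
  [LyonsPeres2016]
* T. Hutchcroft, C. R. Math. Acad. Sci. Paris 354 (2016) 944–947, §2 (quasi-transitive setting).
  [Hutchcroft2016]
-/

noncomputable section

namespace Literature.Barriers.CriticalPhenomena

open _root_.MeasureTheory _root_.Filter Literature.Probability.Percolation SimpleGraph
open scoped _root_.ENNReal

variable {V : Type*} {Ω : Type*} [MeasurableSpace Ω] {G : SimpleGraph V} [G.LocallyFinite]

/-- **The MTP contradiction for unit-mass point allocations, quasi-transitive form.** Let `τ` be
an equivariant measurable point allocation on an `Aut(G)`-invariant finite measure space, and
`Bad x` an invariant measurable family of events such that, almost surely on `Bad x`, infinitely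
many vertices of weight `≥ c` (`c > 0`, possibly random) are allocated to `x`. Then `P(Bad x) = 0`
for every `x`. ("The expected mass received is infinite. The expected mass sent out is at most
`1`. This MTP contradiction …") [cite: Timar2006, Lemma 5.3 (proof: the MTP contradiction)] [cite: LyonsPeres2016, §8.2 (Cor. 8.11)] -/
theorem measure_eq_zero_of_infinite_senders_quasiTransitive (hconn : G.Connected)
    (hqt : IsQuasiTransitive G) (μ : Measure Ω) [IsFiniteMeasure μ] (act : (G ≃g G) → Ω → Ω)
    (hact : ∀ γ, Measurable (act γ)) (hμ : ∀ γ, μ.map (act γ) = μ) {τ : Ω → V → Option V}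
    (hτm : ∀ x y, MeasurableSet {ξ | τ ξ x = some y})
    (hτinv : ∀ γ ξ x, τ (act γ ξ) (γ x) = (τ ξ x).map γ) (o : V) (Bad : V → Set Ω)
    (hBm : ∀ x, MeasurableSet (Bad x)) (hBinv : ∀ (γ : G ≃g G) x, act γ ⁻¹' Bad (γ x) = Bad x)
    (hrecv : ∀ x, ∀ᵐ ξ ∂μ, ξ ∈ Bad x → ∃ c : ℝ≥0∞, c ≠ 0 ∧
      ({y | τ ξ y = some x} ∩ {y | c ≤ autWeight G o y}).Infinite) (x : V) :
    μ (Bad x) = 0 := by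
  classical
  obtain ⟨R, hR, hR'⟩ := hqt.exists_orbit_representatives
  have hRne : R.Nonempty := by obtain ⟨r, hr, -⟩ := hR o; exact ⟨r, hr⟩
  -- the transport `φ(x, y) = 1[τ x = y]` is equivariant
  have hφinv : ∀ (γ : G ≃g G) (x y : V) (ξ : Ω),
      ({y' | τ (act γ ξ) (γ x) = some y'} : Set V).indicator (1 : V → ℝ≥0∞) (γ y) =
        ({y' | τ ξ x = some y'} : Set V).indicator (1 : V → ℝ≥0∞) y := by
    intro γ x y ξ
    have key : (γ y ∈ {y' | τ (act γ ξ) (γ x) = some y'}) ↔ (y ∈ {y' | τ ξ x = some y'}) := by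
      simp only [Set.mem_setOf_eq, hτinv, Option.map_eq_some_iff]
      constructor
      · rintro ⟨z, hz, hzy⟩
        rw [hz, γ.injective hzy]
      · exact fun h => ⟨y, h, rfl⟩
    simp only [Set.indicator_apply, key, Pi.one_apply]
  -- at the representatives
  have hrep : ∀ r ∈ R, μ (Bad r) = 0 := by
    by_contra hno
    push Not at hno
    obtain ⟨r, hr, hne⟩ := hno
    have hmtp := sum_inv_autWeight_mul_lintegral_tsum_eq_tilted G hconn R hR hR' μ act hact hμ
      (F := fun x y ξ => ({y' | τ ξ x = some y'} : Set V).indicator (1 : V → ℝ≥0∞) y)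
      (fun x y => measurable_one.indicator (hτm x y)) hφinv o
    -- left side: each vertex sends `≤ 1`
    have hle : ∑ i ∈ R, (autWeight G o i)⁻¹ *
        ∫⁻ ξ, ∑' y, ({y' | τ ξ i = some y'} : Set V).indicator (1 : V → ℝ≥0∞) y ∂μ ≠ ⊤ := by
      refine ENNReal.sum_ne_top.2 fun i _ => ENNReal.mul_ne_top
        (ENNReal.inv_ne_top.2 (autWeight_ne_zero G hconn o i)) (ne_top_of_le_ne_top (measure_ne_top μ Set.univ) ?_)
      calc ∫⁻ ξ, ∑' y, ({y' | τ ξ i = some y'} : Set V).indicator (1 : V → ℝ≥0∞) y ∂μ ≤ ∫⁻ _, 1 ∂μ := by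
            refine lintegral_mono fun ξ => ?_
            rw [tsum_indicator_eq_some]
            exact Set.indicator_apply_le' (fun _ => le_rfl) (fun _ => zero_le_one)
        _ = μ Set.univ := by rw [lintegral_const, one_mul]
    -- right side at `r`: `∞`
    have hge : ∫⁻ ξ, ∑' y, ({y' | τ ξ y = some y'} : Set V).indicator (1 : V → ℝ≥0∞) r * relWeight G R y ∂μ = ⊤ := by
      refine eq_top_iff.2 ?_
      have hae : ∀ᵐ ξ ∂μ, (Bad r).indicator (fun _ => (⊤ : ℝ≥0∞)) ξ ≤
          ∑' y, ({y' | τ ξ y = some y'} : Set V).indicator (1 : V → ℝ≥0∞) r * relWeight G R y := by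
        filter_upwards [hrecv r] with ξ hξ
        by_cases hB : ξ ∈ Bad r
        · obtain ⟨c, hc0, hinf⟩ := hξ hB
          rw [Set.indicator_of_mem hB, top_le_iff, tsum_indicator_eq_some_mul]
          set S := {y | τ ξ y = some r} ∩ {y | c ≤ autWeight G o y} with hS
          -- each sender in `S` contributes `≥ c / max_R w`
          set ε : ℝ≥0∞ := c / repWeightMax G o R hRne with hε
          have hε0 : ε ≠ 0 := by
            rw [hε]
            exact (ENNReal.div_pos hc0 (repWeightMax_ne_top hconn o hRne)).ne'
          have hlow : ∀ y ∈ S, ε ≤ relWeight G R y := by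
            rintro y ⟨-, hy⟩
            rw [hε]
            refine ENNReal.div_le_of_le_mul ?_
            exact hy.trans (autWeight_le_relWeight_mul_repWeightMax hconn o hR hRne y)
          have h1 : ∑' y, S.indicator (fun _ => ε) y ≤ ∑' y, {y | τ ξ y = some r}.indicator (relWeight G R) y := by
            refine ENNReal.tsum_le_tsum fun y => ?_
            by_cases hy : y ∈ S
            · rw [Set.indicator_of_mem hy, Set.indicator_of_mem hy.1]
              exact hlow y hy
            · rw [Set.indicator_of_notMem hy]
              exact bot_le
          rw [tsum_indicator_const, Set.encard_eq_top_iff.2 hinf, ENat.toENNReal_top,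
            ENNReal.top_mul hε0, top_le_iff] at h1
          exact h1
        · rw [Set.indicator_of_notMem hB]
          exact bot_le
      calc (⊤ : ℝ≥0∞) = ⊤ * μ (Bad r) := by rw [ENNReal.top_mul hne]
        _ = ∫⁻ ξ, (Bad r).indicator (fun _ => (⊤ : ℝ≥0∞)) ξ ∂μ := by rw [lintegral_indicator_const (hBm r)]
        _ ≤ _ := lintegral_mono_ae hae
    have htop : ∑ j ∈ R, (autWeight G o j)⁻¹ *
        ∫⁻ ξ, ∑' y, ({y' | τ ξ y = some y'} : Set V).indicator (1 : V → ℝ≥0∞) j * relWeight G R y ∂μ = ⊤ := by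
      refine ENNReal.sum_eq_top.2 ⟨r, hr, ?_⟩
      rw [hge, ENNReal.mul_top (ENNReal.inv_ne_zero.2 (autWeight_ne_top G hconn o r))]
    rw [htop] at hmtp
    exact hle hmtp
  -- any vertex, by invariance
  obtain ⟨r, hr, ⟨γ, rfl⟩⟩ := hR x
  calc μ (Bad (γ r)) = (μ.map (act γ)) (Bad (γ r)) := by rw [hμ γ]
    _ = μ (act γ ⁻¹' Bad (γ r)) := Measure.map_apply (hact γ) (hBm _)
    _ = μ (Bad r) := by rw [hBinv γ r]
    _ = 0 := hrep r hr

end Literature.Barriers.CriticalPhenomena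

end
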